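import Summits.Ventures.HodgeRepro2.T5NormOneCharacters

/-!
# The norm-one units `Γ = E¹ ∩ O_E^×` are finitely generated (Dirichlet)

Kernel support (seat p3, cell pub-hodge-repro2) behind §F.2 of `route/T5-route-3.md` (the auxiliary
modulus): «`Γ_𝔪 := E¹ ∩ H_𝔪`, a congruence subgroup (modulus `𝔪`) of the finitely generated group
`Γ := E¹ ∩ O_E^×` of norm-one units (Dirichlet)». The arithmetic input is Mathlib's Dirichlet unit
theorem in the form `Module.Finite ℤ (Additive (𝓞 K)ˣ)`; what this file adds is the one-line
[A] «a subgroup of a finitely generated abelian group is finitely generated» (ℤ is Noetherian)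
and its instance on the norm-one units of a number field with a ring involution `c`:

* `subgroup_fg_of_finite`: every subgroup of a commutative group `G` with `Module.Finite ℤ
  (Additive G)` is finitely generated; `subgroup_fg_of_fg` the same from `Group.FG G`;
* `subgroup_units_fg`: every subgroup of `(𝓞 K)ˣ`, `K` a number field, is finitely generated;
* `unitsConjInt c`, `normOneUnits K c = {u ∈ (𝓞 K)ˣ : u · c(u) = 1}` (p2's `normOne` applied to
  the involution of `(𝓞 K)ˣ` induced by `c`), `mem_normOneUnits_iff`, and
  `normOneUnits_eq_comap`: `Γ` is the preimage in `(𝓞 K)ˣ` of file 31's `E¹ = normOne (unitsConj c)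
  ⊆ Kˣ` — the literal «`E¹ ∩ O_E^×`»;
* `normOneUnits_fg` / `group_fg_normOneUnits`: `Γ` is finitely generated.

What stays prose: Chevalley's theorem on units (every finite-index subgroup of `Γ` contains a
congruence subgroup of a modulus prime to a given finite set), the compactness of `E¹(𝔸)/E¹` and
the Pontryagin extension (§F.2's remaining steps; the descent criterion and the finite index of
`ker(ψ_T|_Γ)` are file 73). Header declaration (README §8(d)): uses an L-value-free
non-vanishing device: no.
-/

namespace Summit.Ventures.HodgeRepro2.T5NormOneUnitsFG

open NumberField ShimuraData.B3Characters T5NormOneCharacters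

section General

variable {G : Type*} [CommGroup G]

/-- A subgroup of a finitely generated commutative group is finitely generated: `ℤ` is Noetherian,
so a finitely generated `ℤ`-module is Noetherian and all its submodules are finitely generated. -/
theorem subgroup_fg_of_finite [Module.Finite ℤ (Additive G)] (S : Subgroup G) : S.FG := by
  haveI : IsNoetherian ℤ (Additive G) := isNoetherian_of_isNoetherianRing_of_finite ℤ (Additive G)
  rw [Subgroup.fg_iff_add_fg]
  have h := IsNoetherian.noetherian (AddSubgroup.toIntSubmodule (Subgroup.toAddSubgroup S))
  rwa [Submodule.fg_iff_addSubgroup_fg, AddSubgroup.toIntSubmodule_toAddSubgroup] at h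

/-- The same, as `Group.FG` of the subgroup. -/
theorem group_fg_subgroup_of_finite [Module.Finite ℤ (Additive G)] (S : Subgroup G) :
    Group.FG S :=
  (Group.fg_iff_subgroup_fg S).2 (subgroup_fg_of_finite S)

/-- A subgroup of a finitely generated commutative group is finitely generated (`Group.FG` form). -/
theorem subgroup_fg_of_fg [Group.FG G] (S : Subgroup G) : S.FG := by
  haveI : Module.Finite ℤ (Additive G) := by
    rw [Module.Finite.iff_addGroup_fg, AddGroup.fg_iff_addMonoid_fg, ← Monoid.fg_iff_add_fg]
    exact Group.fg_iff_monoid_fg.1 inferInstance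
  exact subgroup_fg_of_finite S

end General

section Involution

variable (K : Type*) [Field K]

/-- The involution of `(𝓞 K)ˣ` induced by a ring automorphism `c` of `K` (which preserves the ring
of integers). -/
def unitsConjInt (c : K ≃+* K) : (𝓞 K)ˣ ≃* (𝓞 K)ˣ :=
  Units.mapEquiv (RingOfIntegers.mapRingEquiv c).toMulEquiv

/-- `unitsConjInt c` acts on the underlying element of `K` as `c`. -/
theorem coe_unitsConjInt (c : K ≃+* K) (u : (𝓞 K)ˣ) :
    ((unitsConjInt K c u : 𝓞 K) : K) = c ((u : 𝓞 K) : K) :=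
  rfl

/-- The norm-one units `Γ = {u ∈ (𝓞 K)ˣ : u · c(u) = 1}` (p2's `normOne` on `(𝓞 K)ˣ`). -/
def normOneUnits (c : K ≃+* K) : Subgroup (𝓞 K)ˣ :=
  normOne (unitsConjInt K c)

/-- Membership in `Γ`, read in `K`: `u · c(u) = 1`. -/
theorem mem_normOneUnits_iff (c : K ≃+* K) (u : (𝓞 K)ˣ) :
    u ∈ normOneUnits K c ↔ ((u : 𝓞 K) : K) * c ((u : 𝓞 K) : K) = 1 := by
  change u * unitsConjInt K c u = 1 ↔ _
  rw [Units.ext_iff, Units.val_mul, Units.val_one, RingOfIntegers.ext_iff]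
  push_cast
  exact Iff.rfl

/-- The inclusion `(𝓞 K)ˣ →* Kˣ`. -/
def unitsToField : (𝓞 K)ˣ →* Kˣ :=
  Units.map (algebraMap (𝓞 K) K).toMonoidHom

/-- `unitsToField` is the coercion on underlying elements. -/
theorem coe_unitsToField (u : (𝓞 K)ˣ) : (unitsToField K u : K) = ((u : 𝓞 K) : K) :=
  rfl

/-- «`Γ = E¹ ∩ O_E^×`»: the norm-one units are the preimage in `(𝓞 K)ˣ` of file 31's norm-one
group `E¹ = normOne (unitsConj c) ⊆ Kˣ`. -/
theorem normOneUnits_eq_comap (c : K ≃+* K) :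
    normOneUnits K c = (normOne (unitsConj c)).comap (unitsToField K) := by
  ext u
  rw [Subgroup.mem_comap, mem_normOneUnits_iff]
  change _ ↔ unitsToField K u * unitsConj c (unitsToField K u) = 1
  rw [Units.ext_iff, Units.val_mul, Units.val_one, coe_unitsToField]
  rfl

end Involution

section NumberField

variable (K : Type*) [Field K] [NumberField K]

/-- DIRICHLET, subgroup form: every subgroup of the unit group `(𝓞 K)ˣ` of a number field is
finitely generated (Mathlib: `Module.Finite ℤ (Additive (𝓞 K)ˣ)`). -/
theorem subgroup_units_fg (S : Subgroup (𝓞 K)ˣ) : S.FG :=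
  subgroup_fg_of_finite S

/-- The same, as `Group.FG`. -/
theorem group_fg_subgroup_units (S : Subgroup (𝓞 K)ˣ) : Group.FG S :=
  group_fg_subgroup_of_finite S

/-- DIRICHLET for the norm-one units: `Γ` is finitely generated. -/
theorem normOneUnits_fg (c : K ≃+* K) : (normOneUnits K c).FG :=
  subgroup_units_fg K _

/-- The same, as `Group.FG Γ`. -/
theorem group_fg_normOneUnits (c : K ≃+* K) : Group.FG (normOneUnits K c) :=
  group_fg_subgroup_units K _

/-- Every subgroup of `Γ` (e.g. a congruence subgroup `Γ_𝔪`, or the kernel of `ψ_T|_Γ`) is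
finitely generated as well. -/
theorem subgroup_normOneUnits_fg (c : K ≃+* K) (S : Subgroup (normOneUnits K c)) : S.FG := by
  haveI : Group.FG (normOneUnits K c) := group_fg_normOneUnits K c
  exact subgroup_fg_of_fg S

end NumberField

end Summit.Ventures.HodgeRepro2.T5NormOneUnitsFG
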